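import Summits.ResolutionOfSingularities.ResolutionOfSingularities.Theorems.MarkedTransferCampaignW46GoodProcrastination
import Summits.ResolutionOfSingularities.ResolutionOfSingularities.Theorems.MarkedTransferCampaignW46FinPermissibleRunCons
import Literature.AlgebraicGeometry.Resolution.RegularCentreBlowupSeqIntegral
import HarnessLib

/-!
# [OURS · L1 W4.6 rung (i-h)] RUNG (i-h) IN THE CURRENCY OF FINITE PERMISSIBLE SEQUENCES: from every standard surface state
# over a perfect field a `FinPermissibleRun` ends resolved (cell res-hironaka, LADDER-RESOLUTION rung L, D-0089; campaign
# s46, prover res-L1-s46-pv-1; host route MarkedTransfer, `--supports stmt-ResolutionOfSingularities-16155`)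

HONEST FRAMING. Nothing here is a statement of H. Hironaka's manuscript (2017-03-23, [Hironaka2017]) and nothing here
asserts that any statement of it holds. OURS bookkeeping only; résumé-free. AI-written; weaker than expert review.
No `sorry`; axioms standard.

## What

Rung (i-h) (`exists_permissibleReaches_resolved`, p539260) produces a resolved state REACHABLE by finitely many
§2.1-permissible steps (`PermissibleReaches`, a reflexive-transitive closure). The sibling rungs of slot W4.6 speak the
sequence types `PermissibleRun` / `FinPermissibleRun` (res-L1-s46-pv-1 p485314, `cons`/`nil` API by res-D-brk-2
p508…, `…FinPermissibleRunCons`). This file converts: standardness and the dimension bound PERSIST along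
`PermissibleReaches` (`PermissibleReaches.isStandard`, `PermissibleReaches.dimLE`), a reachable state is the last stage
of a `FinPermissibleRun` from the initial one (`PermissibleReaches.exists_finPermissibleRun`), whence **rung (i-h) as a
finite permissible sequence** — `exists_finPermissibleRun_resolved`: from every standard ideal exponent on an ambient
datum of dimension `≤ 2` over a perfect field `K : Type` there is a `FinPermissibleRun` starting there, all of whose
stages are surface states, whose last ideal exponent has EMPTY singular locus.

## References

* companions `…GoodProcrastination` (p539260), `…FinPermissibleRunCons`, `…FiniteExitBound` (the sequence types).
* H. Hironaka, ms. 2017-03-23, §2.1 p.4 l.34–39, Def. 2.1 p.5, Th. 16.13 p.87 l.26–28 — scope only, under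
  adjudication, not cited as fact. [Hironaka2017]
-/

noncomputable section

set_option linter.dupNamespace false -- mandated namespace of this single-conjunct summit

open CategoryTheory AlgebraicGeometry TopologicalSpace

namespace Summit.ResolutionOfSingularities.ResolutionOfSingularities.Theorems

namespace CampaignW46

open Literature.AlgebraicGeometry.Resolution
open Literature.AlgebraicGeometry.Hironaka2017.S02Preliminaries
open Literature.AlgebraicGeometry.Hironaka2017.Datum
open Scheme.IdealSheafData

universe u

variable {p : ℕ} [Fact p.Prime] {K : Type u} [Field K] [CharP K p]

/-! ## Standardness and the dimension bound persist along permissible steps -/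

/-- **The transform of a standard ideal exponent along a §2.1-permissible blow-up is standard**: the centre `D ⊆ Sing(E)`
is a proper closed subset (`J ≠ 0`), so `J𝒪_{Z′} ≠ 0` (tree `IsBlowup.comap_ne_bot`) and `J′ ⊇ J𝒪_{Z′}`; `b` is
unchanged. [folklore] -/
theorem IsStandard.transform_of_isPermissibleCentre (A A' : AmbientDatum p K) {E : IdealExponent A.Z}
    (hE : E.IsStandard) {D : Closeds A.Z} (hD : E.IsPermissibleCentre A.hom D) {π : A'.Z ⟶ A.Z}
    (hπ : IsBlowup π (vanishingIdeal D)) : (E.transform π D).IsStandard := by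
  haveI := ambient_isIntegral A
  have hne : (D : Set A.Z) ≠ Set.univ := ne_univ_of_subset_sing A hE hD.subset_sing
  have hDtop : (vanishingIdeal D).support ≠ ⊤ := by
    intro h
    apply hne
    have := congrArg (fun S : Closeds A.Z => (S : Set A.Z)) h
    simpa [Scheme.IdealSheafData.coe_support_vanishingIdeal] using this
  refine ⟨fun hbot => hπ.comap_ne_bot hDtop hE.1 ?_, hE.2⟩
  have hle : E.J.comap π ≤ (E.transform π D).J := comap_le_controlledTransform π (vanishingIdeal D) E.J E.b
  rw [hbot] at hle
  exact le_bot_iff.1 hle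

namespace PermissibleReaches

variable {A₀ : AmbientDatum p K} {E₀ : IdealExponent A₀.Z}

/-- Standardness persists along finitely many §2.1-permissible steps. [folklore] -/
theorem isStandard {A : AmbientDatum p K} {E : IdealExponent A.Z} (h : PermissibleReaches A₀ E₀ A E)
    (h₀ : E₀.IsStandard) : E.IsStandard := by
  induction h with
  | refl => exact h₀
  | step D π _ hD _ hπ ih => exact IsStandard.transform_of_isPermissibleCentre _ _ ih hD hπ

/-- The dimension bound persists along finitely many §2.1-permissible steps (blowing up does not raise the dimension,
tree `IsBlowup.topologicalKrullDim_le`). [folklore] -/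
theorem dimLE {d : ℕ} {A : AmbientDatum p K} {E : IdealExponent A.Z} (h : PermissibleReaches A₀ E₀ A E)
    (h₀ : Regime.dimLE d A₀ E₀) : Regime.dimLE d A E := by
  induction h with
  | refl => exact h₀
  | @step A E A' D π _ _ _ hπ ih =>
    haveI := ambient_isIntegral A
    haveI : IsLocallyNoetherian A.Z := ambient_isLocallyNoetherian A
    exact hπ.topologicalKrullDim_le ih

/-- **A reachable state is the last stage of a finite §2.1-permissible sequence from the initial state**, every stage
of which is reachable (so inherits standardness and any dimension bound). Built backwards with
`FinPermissibleRun.cons`. [folklore] -/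
theorem exists_finPermissibleRun {A : AmbientDatum p K} {E : IdealExponent A.Z} (h : PermissibleReaches A₀ E₀ A E)
    (h₀ : E₀.IsStandard) :
    ∀ r : FinPermissibleRun p K, (⟨r.A 0, r.E 0⟩ : Σ B : AmbientDatum p K, IdealExponent B.Z) = ⟨A, E⟩ →
      (∀ k, k ≤ r.len → PermissibleReaches A₀ E₀ (r.A k) (r.E k)) →
      ∃ r' : FinPermissibleRun p K, (⟨r'.A 0, r'.E 0⟩ : Σ B : AmbientDatum p K, IdealExponent B.Z) = ⟨A₀, E₀⟩ ∧
        (⟨r'.A r'.len, r'.E r'.len⟩ : Σ B : AmbientDatum p K, IdealExponent B.Z) = ⟨r.A r.len, r.E r.len⟩ ∧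
        ∀ k, k ≤ r'.len → PermissibleReaches A₀ E₀ (r'.A k) (r'.E k) := by
  induction h with
  | refl => exact fun r hr hreach => ⟨r, hr, rfl, hreach⟩
  | @step A E A' D π h hD hhom hπ ih =>
    intro r hr hreach
    obtain ⟨hA, hE⟩ := Sigma.mk.inj_iff.mp hr
    subst hA
    have hE' : r.E 0 = E.transform π D := eq_of_heq hE
    have hEstd : E.IsStandard := h.isStandard h₀
    let r₁ := r.cons A E D π hEstd hD hhom hπ hE'
    have hreach₁ : ∀ k, k ≤ r₁.len → PermissibleReaches A₀ E₀ (r₁.A k) (r₁.E k) := by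
      intro k hk
      cases k with
      | zero => exact h
      | succ k => exact hreach k (Nat.le_of_succ_le_succ hk)
    obtain ⟨r', h0, hlast, hreach'⟩ := ih r₁ rfl hreach₁
    exact ⟨r', h0, hlast, hreach'⟩

end PermissibleReaches

/-! ## Rung (i-h) as a finite permissible sequence -/

/-- [OURS · L1 W4.6 rung (i-h)] NOT a statement of the manuscript. **RUNG (i-h) IN SEQUENCE FORM.** Over a perfect field
`K : Type` of characteristic `p`: from every standard ideal exponent `E₀` on an ambient datum `A₀` of dimension `≤ 2`
there is a FINITE §2.1-permissible sequence (`FinPermissibleRun`: standard stages, permissible centres, blow-ups,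
transforms of Def. 2.1, same base field) with stage `0` equal to `(A₀, E₀)`, all stages of dimension `≤ 2`, whose LAST
ideal exponent is RESOLVED: `Sing = ∅`. (From `exists_permissibleReaches_resolved`, p539260.) Replaces the role of the
resolution clause of Th. 16.13 p.87 l.26–28 on surfaces by OUR procedure; says nothing about the manuscript's.
[folklore] -/
theorem exists_finPermissibleRun_resolved {K : Type} [Field K] [CharP K p] [PerfectField K] (A₀ : AmbientDatum p K)
    (E₀ : IdealExponent A₀.Z) (hE₀ : E₀.IsStandard) (hdim₀ : Regime.dimLE 2 A₀ E₀) :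
    ∃ r : FinPermissibleRun p K, (⟨r.A 0, r.E 0⟩ : Σ B : AmbientDatum p K, IdealExponent B.Z) = ⟨A₀, E₀⟩ ∧
      (r.E r.len).sing = ∅ ∧ ∀ k, k ≤ r.len → Regime.dimLE 2 (r.A k) (r.E k) := by
  obtain ⟨A, E, hreach, hres⟩ := exists_permissibleReaches_resolved A₀ E₀ hE₀ hdim₀
  obtain ⟨r, h0, hlast, hreach'⟩ := hreach.exists_finPermissibleRun hE₀ (FinPermissibleRun.nil A E (hreach.isStandard hE₀))
    rfl (fun _ _ => hreach)
  refine ⟨r, h0, ?_, fun k hk => (hreach' k hk).dimLE hdim₀⟩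
  -- the last stage of `r` is `(A, E)`
  have hl : (⟨r.A r.len, r.E r.len⟩ : Σ B : AmbientDatum p K, IdealExponent B.Z) = ⟨A, E⟩ := hlast
  obtain ⟨hA, hE⟩ := Sigma.mk.inj_iff.mp hl
  -- transport `Sing = ∅` along the identification of the last stage
  revert hE
  generalize r.E r.len = E'
  intro hE
  cases hA
  cases (eq_of_heq hE)
  exact hres

end CampaignW46

end Summit.ResolutionOfSingularities.ResolutionOfSingularities.Theorems

end
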